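import Summits.QuantumFields.YangMills.Theorems.ToronSmallBallSiteTwistDefs
import Summits.QuantumFields.YangMills.Theorems.QuantileBitPuritySU2ClassShiftDefs
import HarnessLib

/-!
# The seam-axis («g-axis») transported sheet shift of the periodic seam sector — definitions

Defs module (D-0009) for the ONE-TRANSLATE core estimate in the untwisted seam sector of the thermal ring (crux ⟨stmt-QuantumFields-23948⟩
`QuantileBitPurity.HolonomyQuantileSubQuartic`, LINE g12-B of seat ym-idea-4; memo HOME `bc/g15-dw/PLAN-CORE-GAXIS.md`, simplified by seat
ym-dw-p1 g16: the transport is read from slice `0` only, no fractional rotation).  On the spatial torus `(ℤ/L)³` with `SU(2)` links, with the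
quaternion model `q = su2Quat`, `expPoint v = exp(ι v)`, `axisVec W = Im q_W/‖Im q_W‖`:

* `gAxis χ₀ σ₁ g₀ P₁ P₂ ∈ ℝ³` — the AXIS RULE: the axis of the seam field `g₀ = g(0)` if it is `χ₀`-non-central (`χ₀ ≤ ‖Im q_{g₀}‖`), else the
  axis of the `y`-holonomy `P₁` if `σ₁`-non-central, else the axis of the `z`-holonomy `P₂` if `σ₁`-non-central, else the fixed axis `e₃`;
* `sheetTransport U x = C_{x₂}(U) · R_{x₂,x₁}(U)` — the COMB TRANSPORT from the origin to the plane site `(0, x₁, x₂)`: `x₂` steps along `e₂`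
  (`lineHolonomy U 2 x₂ 0`), then `x₁` steps along `e₁` (`lineHolonomy U 1 x₁ (x₂ e₂)`); it reads `y`- and `z`-links only;
* `gAxisElt θ χ₀ σ₁ g U = exp(ι θ · gAxis χ₀ σ₁ (g 0) (P_y(U)) (P_z(U)))` with `P_y(U) = lineHolonomy U 1 L 0`, `P_z(U) = lineHolonomy U 2 L 0` — the
  rotation by `θ` about the chosen axis, and the TRANSPORTED FIELD `gAxisField θ χ₀ σ₁ g U x = W_x⁻¹ · gAxisElt · W_x`, `W_x = sheetTransport U x`;
* `gAxisShift θ χ₀ σ₁ g U⃗ = (t ↦ siteTwist 0 (gAxisField θ χ₀ σ₁ g U⃗₀) U⃗_t)` — the SHEET SHIFT of a chain of slices: every `x`-link issuing from the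
  plane `x₀ = 0` of EVERY slice is multiplied on the left by the field read from slice `0` (so interior time couplings are exactly invariant and the
  map preserves `⊗ Haar` by `measurePreserving_chain_siteTwist_of_indep`), and the `x`-holonomy through the origin of slice `0` becomes
  `gAxisElt · P_x` (leaves the core).

DEFINITIONS ONLY (+ `rfl` lemmas); identities and estimates are in the companion proof modules `QuantileBitPurityGAxis*`.  HONEST FRAMING:
fixed-lattice bookkeeping objects; nothing about infinite volume, the continuum limit or the Clay gap.  References: [cite: Luscher1983, §2];
[cite: tHooft1979].
-/

set_option autoImplicit false

noncomputable section

open scoped Quaternion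
open Literature.MathematicalPhysics.QuantumFieldTheory
open Literature.MathematicalPhysics.QuantumLattice
open Literature.MathematicalPhysics.QuantumFieldTheory.Balaban1983to89.T4HaarSU2ExpChart (expPoint)

namespace Summit.QuantumFields.YangMills.Theorems.FemtoTransferGap.GAxis

open ClassShift

variable {L : ℕ}

/-- **The axis rule.**  Given thresholds `χ₀, σ₁` and three group elements (seam field at the origin, `y`- and `z`-holonomy through the origin):
the unit axis of the first one that is non-central at its threshold (`χ₀ ≤ ‖Im q_{g₀}‖`, then `σ₁ ≤ ‖Im q_{P₁}‖`, then `σ₁ ≤ ‖Im q_{P₂}‖`), and the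
fixed axis `e₃` if all three are near-central. [cite: Luscher1983, §2] -/
def gAxis (χ₀ σ₁ : ℝ) (g₀ P₁ P₂ : SU2) : EuclideanSpace ℝ (Fin 3) :=
  if χ₀ ≤ ‖imVec (su2Quat g₀)‖ then axisVec g₀
  else if σ₁ ≤ ‖imVec (su2Quat P₁)‖ then axisVec P₁
  else if σ₁ ≤ ‖imVec (su2Quat P₂)‖ then axisVec P₂
  else EuclideanSpace.single 2 1

/-- **The comb transport** from the origin to the plane site `x` (`x₀` is ignored): `x₂` steps along `e₂` from `0`, then `x₁` steps along `e₁`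
(representatives `ZMod.val`).  Reads only `y`- and `z`-links. [cite: Luscher1983, §2] -/
def sheetTransport (U : GaugeConfig 3 L SU2) (x : Site 3 L) : SU2 :=
  lineHolonomy U 2 (x 2).val 0 * lineHolonomy U 1 (x 1).val (Pi.single 2 (x 2))

/-- **The reference rotation** `exp(ι θ · gAxis)` at the origin: angle `θ`, axis chosen by the axis rule from the seam field `g 0` and the `y`- and
`z`-holonomies of `U` through the origin. [cite: Luscher1983, §2] -/
def gAxisElt (θ χ₀ σ₁ : ℝ) (g : Site 3 L → SU2) (U : GaugeConfig 3 L SU2) : SU2 :=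
  expPoint (θ • gAxis χ₀ σ₁ (g 0) (lineHolonomy U 1 L 0) (lineHolonomy U 2 L 0))

/-- **The transported rotation field** `x ↦ W_x⁻¹ · gAxisElt · W_x`, `W_x = sheetTransport U x` (covariantly constant along the comb of `U`).
[cite: Luscher1983, §2] -/
def gAxisField (θ χ₀ σ₁ : ℝ) (g : Site 3 L → SU2) (U : GaugeConfig 3 L SU2) (x : Site 3 L) : SU2 :=
  (sheetTransport U x)⁻¹ * gAxisElt θ χ₀ σ₁ g U * sheetTransport U x

/-- **The seam-axis sheet shift of a chain of slices**: every slice is translated (`siteTwist 0`) by the field read from slice `0` and the seam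
field `g`. [cite: Luscher1983, §2] [cite: tHooft1979] -/
def gAxisShift (θ χ₀ σ₁ : ℝ) (g : Site 3 L → SU2) {n : ℕ} (Us : Fin (n + 1) → GaugeConfig 3 L SU2) :
    Fin (n + 1) → GaugeConfig 3 L SU2 :=
  fun t => siteTwist 0 (gAxisField θ χ₀ σ₁ g (Us 0)) (Us t)

/-- `gAxis` unfolded. [folklore] -/
theorem gAxis_def (χ₀ σ₁ : ℝ) (g₀ P₁ P₂ : SU2) : gAxis χ₀ σ₁ g₀ P₁ P₂ =
    if χ₀ ≤ ‖imVec (su2Quat g₀)‖ then axisVec g₀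
    else if σ₁ ≤ ‖imVec (su2Quat P₁)‖ then axisVec P₁
    else if σ₁ ≤ ‖imVec (su2Quat P₂)‖ then axisVec P₂
    else EuclideanSpace.single 2 1 := rfl

/-- `sheetTransport` unfolded. [folklore] -/
theorem sheetTransport_def (U : GaugeConfig 3 L SU2) (x : Site 3 L) :
    sheetTransport U x = lineHolonomy U 2 (x 2).val 0 * lineHolonomy U 1 (x 1).val (Pi.single 2 (x 2)) := rfl

/-- `gAxisElt` unfolded. [folklore] -/
theorem gAxisElt_def (θ χ₀ σ₁ : ℝ) (g : Site 3 L → SU2) (U : GaugeConfig 3 L SU2) :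
    gAxisElt θ χ₀ σ₁ g U = expPoint (θ • gAxis χ₀ σ₁ (g 0) (lineHolonomy U 1 L 0) (lineHolonomy U 2 L 0)) := rfl

/-- `gAxisField` unfolded. [folklore] -/
theorem gAxisField_apply (θ χ₀ σ₁ : ℝ) (g : Site 3 L → SU2) (U : GaugeConfig 3 L SU2) (x : Site 3 L) :
    gAxisField θ χ₀ σ₁ g U x = (sheetTransport U x)⁻¹ * gAxisElt θ χ₀ σ₁ g U * sheetTransport U x := rfl

/-- `gAxisShift` unfolded. [folklore] -/
theorem gAxisShift_apply (θ χ₀ σ₁ : ℝ) (g : Site 3 L → SU2) {n : ℕ} (Us : Fin (n + 1) → GaugeConfig 3 L SU2) (t : Fin (n + 1)) :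
    gAxisShift θ χ₀ σ₁ g Us t = siteTwist 0 (gAxisField θ χ₀ σ₁ g (Us 0)) (Us t) := rfl

end Summit.QuantumFields.YangMills.Theorems.FemtoTransferGap.GAxis

end
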